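import Mathlib
import HarnessLib
import Literature.Computability.AlgebraicComplexity.TripartitionTensor
import Literature.Computability.AlgebraicComplexity.PrattTripartitionRank
import Literature.Computability.AlgebraicComplexity.StrassenSpectralTheorem
import Literature.Computability.AlgebraicComplexity.TensorSemiringSpectrum
import Summits.MatrixMultiplication.MatrixMultiplication.Theses.TripartitionBridge

/-!
# Crux `DUp` (stmt-MatrixMultiplication-6568) — `Lines/birth.lean`, the BC3 birth skeleton

Route `TripartitionBridge` (route-MatrixMultiplication-TripartitionBridge; `closes : DUp → TkMinimal →
GlueOmega → GlueCW90 → MatrixMultiplication`; re-audit bin REPAIRABLE). The crux, with `cw₂ = cwTensor ℂ 2`,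
`T_k = tripartitionTensor ℂ k` (Pratt2024 Def 1.4; the route inlines the term, `tripartitionTensor_def` is
`rfl`), `N_k = binom(3k,k)`, `L_k = log₃ N_k`, `≲ = AsympLe (· ≤ ·)` on Strassen's semiring `T(ℂ)`:

  `DUp : ∀ k p q, 3^p ≤ N_k^q → [cw₂]^p ≲ [T_k]^q`   (host transfer `cw₂`-powers → `T_k`-powers at the
  flattening-exact rate `L_k`, for EVERY `k`).

By Strassen's spectral theorem (`IsStrassenPreorder.asympLe_iff_forall_spectralPoint`, PROVED in tree)
`DUp(k) ⟺ ∀ φ ∈ X(T(ℂ)), φ[cw₂]^{L_k} ≤ φ[T_k]`, i.e. `d_φ(cw₂) ≤ d_φ(T_k)` for the normalised darkness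
`d_φ(T_k) := log φ[T_k] / log N_k` (`= 1` at every known spectral point: gauge points and quantum/support
functionals all read `N_k` on the free, balanced, `S_{3k}`-symmetric `T_k` and `3` on `cw₂ ≅ T_1`).

THE LINE = factor `DUp` through the ASYMPTOTIC INVARIANT of the family, `Λ_φ := lim_k φ[T_k]^{1/k}`
(`= sup_k`, by `T_a ⊠ T_b ≤ T_{a+b}`; `d_φ(∞) := log Λ_φ / log(27/4)`):

  `d_φ(cw₂) ≤ d_φ(∞)`  [GERM, stub 1]   and   `d_φ(∞) ≤ d_φ(T_k)` for `k ≥ 2`  [LAYER CONCENTRATION, stub 2],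

both stated in the route's own `≲`-language with INTEGER exponents, and composed by a sorry-free
rational-rate-chaining argument (no limits: the rates `j·(p'/q')·(p''/q'')` sweep every rational below `L_k`,
and the closed rate `≤ L_k` follows by density).

* `stub_germ` — `∀ p q, 3^p < (27/4)^q → ∃ k₀, ∀ k ≥ k₀, [cw₂]^{kp} ≲ [T_k]^q`: `cw₂`-powers embed into the
  balanced layers at every rate below `κ = log₃(27/4) = 1.7381` PER UNIT OF `k`, eventually in `k`. This is the
  `k → ∞` germ of `DUp` (`DUp ⟹ germ`, via `N_k ≥ (27/4)^k/(3k+1)`), it is EXACTLY what `GlueOmega` consumes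
  (germ ∧ TkMinimal ⟹ `R̃(cw₂) ≤ (27/4 + δ)^{q/p} → 3`), and alone it already pays the record: germ ⟹ `DUpW`
  (`T_k ≤ W^{⊠3k}` is a zeroing) ⟹ `R̃(cw₂) ≤ 8^{1/κ} = 3.3081 < 3.931` (AlmanLi2026). Known: rates `≤ 1` per unit
  (the zeroing `T_k ≥ T_1^{⊠k}`, `tripartitionTensor_restrictsTo_kroneckerPow 1 k`, + the entrance ticket below);
  rates in `(1, κ)` are the open content. Size XL. LOAD-BEARING.
* `stub_layerConcentration` — `∀ j k p q, 1 ≤ j → 2 ≤ k → (27/4)^{jp} ≤ N_k^q → [T_j]^p ≲ [T_k]^q`: inside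
  Pratt's family, the ASYMPTOTIC per-unit capacity `27/4` of `j` source units never exceeds what the EXACT
  flattening capacity `N_k` of the target layer can host ("no finite layer is anomalously bright relative to the
  family's asymptotics"). True with room at every known spectral point (`N_j ≤ (27/4)^j`); `j = k` and `j = 1`
  are provable now (monotonicity; the zeroing `T_k ≥ T_1^{⊠k}` since `log N_k / log(27/4) < k`); for `j ≤ 4`
  it follows from Pratt's `R(T_j) ≤ 8^j/2 ≤ (27/4)^j` (Pratt2024 §1.2) GIVEN the full asymptotic subrank
  `(N_k : T(ℂ)) ≲ [T_k]` (`Q̃(T_k) = N_k`, Strassen 1991 tight-tensor formula — true, not yet in tree); for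
  `j ≥ 5` it is open (`R(T_5) ≤ 16384 > 14013 = (27/4)^5`). Size XL.
* entrance ticket `mk_cwTensor_two_le_mk_tripartitionTensor_one : [cw₂] ≤ [T_1]` — PROVED here (basis
  `e_0, e_1 ± i e_2`; 27 entries by `fin_cases`): the `≤` half of support item CwTwoIsTOne (stmt-6573); it is
  what `DUp` at `k = 1` needs.
* `transfer_of_germ_of_layerConcentration` — the sorry-free real-analysis core (`a = φ[cw₂]`, `t j = φ[T_j]`):
  `pow_le_pow_of_germ_of_layerConcentration` (strict rates: pick `p'/q' ∈ (M log(27/4)/(M' log N_k), κ)`, a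
  source layer `j ≥ k₀(p',q')`, then `p''/q'' ∈ (M q'/(M' p' j), log N_k/(j log(27/4)))`, chain
  `a^{j p' p''} ≤ (t j)^{q' p''} ≤ (t k)^{q' q''}` and extract the `q'q''`-th root) and
  `pow_le_pow_of_strict_rates` (density closes the rate); `k = 0` (`p = 0`) and `k = 1` (`p ≤ q`, ticket) by hand.
* `dUp_of_germ_of_layerConcentration` — the composition with EXPLICIT hypotheses (BC3 shape
  `stub₁-sig → stub₂-sig → ticket → crux-unfolded`), via the spectral theorem in both directions.
* `DUp_of : DUp` — THE skeleton theorem: the crux BY NAME from the two declared stubs (`sorry` occurs ONLY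
  inside `stub_germ`, `stub_layerConcentration`).

Honest status. `DUp ⟹ germ` but `DUp ⇏ layerConcentration`: stub 2 is NOT a consequence of the crux — it is
the regularity that converts the germ into every finite layer, and ANY such converter must bound `d_φ(∞)` by
`d_φ(T_k)`, so it carries a DDown-type flavour ("bright at layer `k` ⟹ asymptotically bright"): under the Set
Cover Conjecture (some `φ` with `Λ_φ ≥ 8 − ε`, Pratt2024 Cor 1.11) stub 2 predicts `R̃(T_k) ≥ N_k^{log 8/log 6.75}
= N_k^{1.089}` at EVERY `k ≥ 2` (`k = 2`: `≥ 19.1 > 15`), where `DUp` alone predicts nothing; `DUp ∧ DDown` (the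
route's full proportionality picture) implies stub 2. Rejected decompositions (recorded so nobody re-walks
them): (i) `[cw₂] ≲ 3` ∧ `N_k ≲ [T_k]` ⟹ `DUp` — true shape of "BThesis ⟹ DUp", but `[cw₂] ≲ 3` IS route B's
thesis and `AsymptoticRankCW.closes : BThesis → MatrixMultiplication` is proved: a summit-strength stub
(costume); (ii) monotone darkness `d_φ(T_k) ≤ d_φ(T_{k+1})` — fragile to the `k^{-1/2}` correction of `N_k` in
any dark world; (iii) `W`-host transfer `d_φ(W) ≤ d_φ(T_k)` — FALSE at the first flattening rank
(`8^{log N_k/log 6.75} = N_k^{1.089} > N_k`). For the tenure/repair planner (not acted on here): `closes` only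
ever uses the germ — `stub_germ ∧ TkMinimal ⟹ BThesis` by the GlueOmega argument verbatim.

Disproof used: none exists — `ledger crux ls stmt-MatrixMultiplication-6568` had no workfiles (no
`Disproof.lean`, no `Negative/`), and `ledger negatives --problem MatrixMultiplication` (7 entries, 2026-08-17)
has no statement about `cwTensor`, `tripartitionTensor` or `AsympLe`. Kill inherited from the route: a
universal spectral point with `φ[cw₂] > 8^{1/κ} = 3.3081` refutes stub 1 (and `DUpW`, and `DUp` for large `k`);
`φ[cw₂] > 3` with `φ[T_k] = N_k` refutes `DUp(k)` directly.
-/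

-- `Summit.<Summit>.<Problem>`: for the single-conjunct summit the duplicate component is mandated.
set_option linter.dupNamespace false

noncomputable section

namespace Summit.MatrixMultiplication.MatrixMultiplication.Cruxes.DUp.Birth

open Literature.Computability.AlgebraicComplexity
open Summit.MatrixMultiplication.MatrixMultiplication.Theses.TripartitionBridge

/-! ## The registered stubs -/

/-- **Stub 1 — the GERM of `DUp` (entropy-rate host transfer in the limit `k → ∞`).** For every
rate `p/q` below `κ = log₃(27/4) = 1.7381` *per unit of `k`* (`3^p < (27/4)^q`), and all large `k`,
`[cw₂]^{kp} ≲ [T_k]^q` in Strassen's asymptotic preorder on `T(ℂ)`. Spectrally: `φ[cw₂]^κ ≤ Λ_φ =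
lim_k φ[T_k]^{1/k}` for every spectral point `φ`. Why plausibly true: equality at every known spectral point
(`3^κ = 27/4 = lim N_k^{1/k}`); implied by `DUp`; known at rates `≤ 1` (zeroing `T_k ≥ T_1^{⊠k}`). Why it might
fail: a spectral point dark at `cw₂` by more than the family is dark asymptotically (`φ[cw₂] > Λ_φ^{1/κ}`); in
particular any `φ[cw₂] > 8^{1/κ} = 3.3081`. Payoff alone: `R̃(cw₂) ≤ 3.3081` (record) and, with `TkMinimal`,
`R̃(cw₂) = 3`. Size XL. Sources: Pratt2024 = arXiv:2311.02774 (Def 1.4, §1.2), Kaski–Michałek arXiv:2404.06427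
(Ex. 11), ChristandlVranaZuiddam2023, Strassen1988, AlmanLi2026. -/
theorem stub_germ :
    ∀ p q : ℕ, (3 : ℝ) ^ p < ((27 : ℝ) / 4) ^ q →
      ∃ k₀ : ℕ, ∀ k : ℕ, k₀ ≤ k →
        AsympLe (fun x y : TensorClass ℂ => x ≤ y)
          ((TensorClass.mk (cwTensor ℂ 2)) ^ (k * p))
          ((TensorClass.mk (tripartitionTensor ℂ k)) ^ q) := by
  sorry

/-- **Stub 2 — LAYER CONCENTRATION of Pratt's family.** `[T_j]^p ≲ [T_k]^q` whenever
`(27/4)^{jp} ≤ binom(3k,k)^q` (`j ≥ 1`, `k ≥ 2`): the asymptotic per-unit capacity `27/4` of `j` source units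
never exceeds what the exact flattening capacity `binom(3k,k)` of the target layer hosts. Spectrally:
`Λ_φ^{log N_k / log(27/4)} ≤ φ[T_k]`, i.e. no finite layer is brighter (normalised) than the family's
asymptotics. Why plausibly true: holds with room at every known spectral point (`N_j < (27/4)^j`); `j = k`,
`j = 1` provable now; `j ≤ 4` from Pratt's `R(T_j) ≤ 8^j/2 ≤ (27/4)^j` given `Q̃(T_k) = binom(3k,k)` (Strassen
1991, not yet in tree); implied by the route's two-sided picture `DUp ∧ DDown`. Why it might fail: late-onset
darkness — a spectral point bright on `T_2, …, T_k` but with `Λ_φ > 27/4` (under SCC it predicts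
`R̃(T_k) ≥ binom(3k,k)^{1.089}` for every `k ≥ 2`). Size XL. Sources: Pratt2024 = arXiv:2311.02774 (§1.2,
Cor 1.11), Strassen1991, ChristandlVranaZuiddam2023, BjorklundKaski2024. -/
theorem stub_layerConcentration :
    ∀ j k p q : ℕ, 1 ≤ j → 2 ≤ k →
      ((27 : ℝ) / 4) ^ (j * p) ≤ ((Nat.choose (3 * k) k : ℕ) : ℝ) ^ q →
        AsympLe (fun x y : TensorClass ℂ => x ≤ y)
          ((TensorClass.mk (tripartitionTensor ℂ j)) ^ p)
          ((TensorClass.mk (tripartitionTensor ℂ k)) ^ q) := by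
  sorry

/-! ## Sorry-free real-analysis core: rational rate chaining -/

section Analysis

/-- Between two reals `0 ≤ u < v` lies a ratio of positive naturals (no `ℚ` needed:
`n > 1/(v-u)`, `m = ⌊n u⌋ + 1`). [folklore] -/
theorem exists_nat_div_btwn {u v : ℝ} (hu : 0 ≤ u) (huv : u < v) :
    ∃ m n : ℕ, 0 < m ∧ 0 < n ∧ u < (m : ℝ) / n ∧ (m : ℝ) / n < v := by
  have hvu : 0 < v - u := sub_pos.2 huv
  obtain ⟨n, hn⟩ := exists_nat_gt (1 / (v - u))
  have hn0 : (0 : ℝ) < n := lt_trans (by positivity) hn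
  have hn0' : 0 < n := by exact_mod_cast hn0
  refine ⟨⌊(n : ℝ) * u⌋₊ + 1, n, Nat.succ_pos _, hn0', ?_, ?_⟩
  · rw [lt_div_iff₀ hn0]
    have h1 := Nat.lt_floor_add_one ((n : ℝ) * u)
    have h2 : (n : ℝ) * u = u * n := mul_comm _ _
    push_cast
    linarith
  · rw [div_lt_iff₀ hn0]
    have h1 : (⌊(n : ℝ) * u⌋₊ : ℝ) ≤ n * u := Nat.floor_le (by positivity)
    have h2 : 1 < (n : ℝ) * (v - u) := (div_lt_iff₀ hvu).1 hn
    push_cast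
    nlinarith

variable {a : ℝ} {t : ℕ → ℝ}

/-- **Rate chaining (strict rates).** If `a`-powers embed into `t j`-powers at every per-unit rate
below `log (27/4) / log 3` for large `j` (germ), and `t j`-powers embed into `t k`-powers whenever
`(27/4)^{jp} ≤ N_k^q` (layer concentration, `N_k = binom(3k,k)`, `k ≥ 2`), then `a^M ≤ (t k)^{M'}`
for every STRICT rate `M log 3 < M' log N_k`: choose rationals `p'/q' ∈ (M log(27/4)/(M' log N_k),
log(27/4)/log 3)` and `p''/q'' ∈ (M q'/(M' p' j), log N_k/(j log(27/4)))`, chain the two integer-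
exponent inequalities and extract the `q'q''`-th root. [folklore] -/
theorem pow_le_pow_of_germ_of_layerConcentration (ha : 1 ≤ a) (ht : ∀ j, 1 ≤ t j)
    (hG : ∀ p q : ℕ, (3 : ℝ) ^ p < ((27 : ℝ) / 4) ^ q →
      ∃ k₀ : ℕ, ∀ j : ℕ, k₀ ≤ j → a ^ (j * p) ≤ t j ^ q)
    (hLC : ∀ j k p q : ℕ, 1 ≤ j → 2 ≤ k →
      ((27 : ℝ) / 4) ^ (j * p) ≤ ((Nat.choose (3 * k) k : ℕ) : ℝ) ^ q → t j ^ p ≤ t k ^ q)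
    {k : ℕ} (hk : 2 ≤ k) {M M' : ℕ}
    (hMM' : (M : ℝ) * Real.log 3 < (M' : ℝ) * Real.log ((Nat.choose (3 * k) k : ℕ) : ℝ)) :
    a ^ M ≤ t k ^ M' := by
  set ℓ3 : ℝ := Real.log 3 with hℓ3
  set c : ℝ := (27 : ℝ) / 4 with hc
  set ℓc : ℝ := Real.log c with hℓc
  set N : ℝ := ((Nat.choose (3 * k) k : ℕ) : ℝ) with hN
  set ν : ℝ := Real.log N with hν
  have hℓ3pos : 0 < ℓ3 := Real.log_pos (by norm_num)
  have hcgt : (1 : ℝ) < c := by rw [hc]; norm_num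
  have hcpos : (0 : ℝ) < c := lt_trans zero_lt_one hcgt
  have hℓcpos : 0 < ℓc := Real.log_pos hcgt
  have hN2 : 2 ≤ Nat.choose (3 * k) k := by
    have h1 : (k + 1).choose k ≤ (3 * k).choose k := Nat.choose_le_choose k (by omega)
    rw [Nat.choose_succ_self_right] at h1
    omega
  have hNgt : (1 : ℝ) < N := by
    rw [hN]
    exact_mod_cast (lt_of_lt_of_le one_lt_two hN2)
  have hNpos : (0 : ℝ) < N := lt_trans zero_lt_one hNgt
  have hνpos : 0 < ν := Real.log_pos hNgt
  have hM'pos : (0 : ℝ) < M' := by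
    rcases Nat.eq_zero_or_pos M' with h | h
    · exfalso
      rw [h, Nat.cast_zero, zero_mul] at hMM'
      exact absurd hMM' (not_lt.2 (by positivity))
    · exact_mod_cast h
  -- Step A: a rational per-unit rate p'/q' just below κ = ℓc/ℓ3
  have hu1 : 0 ≤ (M : ℝ) * ℓc / ((M' : ℝ) * ν) := by positivity
  have hu1v1 : (M : ℝ) * ℓc / ((M' : ℝ) * ν) < ℓc / ℓ3 := by
    rw [div_lt_div_iff₀ (by positivity) hℓ3pos]
    nlinarith [hMM', hℓcpos]
  obtain ⟨p', q', hp', hq', hlo1, hhi1⟩ := exists_nat_div_btwn hu1 hu1v1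
  have hq'pos : (0 : ℝ) < q' := by exact_mod_cast hq'
  have hp'pos : (0 : ℝ) < p' := by exact_mod_cast hp'
  have h3c : (3 : ℝ) ^ p' < c ^ q' := by
    rw [← Real.log_lt_log_iff (by positivity) (by positivity), Real.log_pow, Real.log_pow]
    have h := (div_lt_div_iff₀ hq'pos hℓ3pos).1 hhi1
    linarith
  obtain ⟨k₀, hk₀⟩ := hG p' q' h3c
  -- Step B: a large source layer j
  set j : ℕ := k₀ + 1 with hj
  have hj1 : 1 ≤ j := Nat.le_add_left 1 k₀
  have hjpos : (0 : ℝ) < j := by exact_mod_cast hj1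
  have hGj : a ^ (j * p') ≤ t j ^ q' := hk₀ j (Nat.le_succ k₀)
  -- Step C: a rational rate p''/q'' for the layer transfer j → k
  have hu2 : 0 ≤ (M : ℝ) * q' / ((M' : ℝ) * p' * j) := by positivity
  have hu2v2 : (M : ℝ) * q' / ((M' : ℝ) * p' * j) < ν / ((j : ℝ) * ℓc) := by
    rw [div_lt_div_iff₀ (by positivity) (by positivity)]
    have h := (div_lt_div_iff₀ (by positivity) hq'pos).1 hlo1
    nlinarith [h, hjpos]
  obtain ⟨p'', q'', hp'', hq'', hlo2, hhi2⟩ := exists_nat_div_btwn hu2 hu2v2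
  have hq''pos : (0 : ℝ) < q'' := by exact_mod_cast hq''
  have hp''pos : (0 : ℝ) < p'' := by exact_mod_cast hp''
  have hcN : c ^ (j * p'') ≤ N ^ q'' := by
    rw [← Real.log_le_log_iff (by positivity) (by positivity), Real.log_pow, Real.log_pow]
    have h := (div_lt_div_iff₀ hq''pos (by positivity)).1 hhi2
    push_cast
    nlinarith [h]
  have hLCj : t j ^ p'' ≤ t k ^ q'' := hLC j k p'' q'' hj1 hk hcN
  -- Step D: chain the two integer-exponent inequalities
  have ha0 : 0 ≤ a := le_trans zero_le_one ha
  have htj0 : 0 ≤ t j := le_trans zero_le_one (ht j)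
  have htk0 : 0 ≤ t k := le_trans zero_le_one (ht k)
  have hchain : a ^ (j * p' * p'') ≤ t k ^ (q'' * q') := by
    calc a ^ (j * p' * p'') = (a ^ (j * p')) ^ p'' := by rw [pow_mul]
      _ ≤ (t j ^ q') ^ p'' := pow_le_pow_left₀ (by positivity) hGj p''
      _ = (t j ^ p'') ^ q' := by rw [← pow_mul, ← pow_mul, mul_comm]
      _ ≤ (t k ^ q'') ^ q' := pow_le_pow_left₀ (by positivity) hLCj q'
      _ = t k ^ (q'' * q') := by rw [← pow_mul]
  -- Step E: the exponents have the right ratio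
  have hexp : M * (q'' * q') ≤ M' * (j * p' * p'') := by
    have h := (div_lt_div_iff₀ (by positivity) hq''pos).1 hlo2
    have h' : (M : ℝ) * (q'' * q') ≤ (M' : ℝ) * (j * p' * p'') := by nlinarith [h]
    exact_mod_cast h'
  -- Step F: root extraction
  have hF : q'' * q' ≠ 0 := Nat.mul_ne_zero (Nat.pos_iff_ne_zero.1 hq'') (Nat.pos_iff_ne_zero.1 hq')
  have key : (a ^ M) ^ (q'' * q') ≤ (t k ^ M') ^ (q'' * q') := by
    calc (a ^ M) ^ (q'' * q') = a ^ (M * (q'' * q')) := by rw [← pow_mul]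
      _ ≤ a ^ (M' * (j * p' * p'')) := pow_le_pow_right₀ ha hexp
      _ = (a ^ (j * p' * p'')) ^ M' := by rw [mul_comm, pow_mul]
      _ ≤ (t k ^ (q'' * q')) ^ M' := pow_le_pow_left₀ (by positivity) hchain M'
      _ = (t k ^ M') ^ (q'' * q') := by rw [← pow_mul, ← pow_mul, mul_comm]
  exact le_of_pow_le_pow_left₀ hF (by positivity) key

/-- **Closing the rate** (from all strict rates to the sharp one). If `a^M ≤ T^{M'}` whenever
`M log 3 < M' ν` (`ν > 0`, `a, T ≥ 1`), then `a^p ≤ T^q` whenever `p log 3 ≤ q ν`: the strict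
rational rates are dense below `ν / log 3`. [folklore] -/
theorem pow_le_pow_of_strict_rates (ha : 1 ≤ a) {T : ℝ} (hT : 1 ≤ T) {ν : ℝ} (_hν : 0 < ν)
    (hcore : ∀ M M' : ℕ, (M : ℝ) * Real.log 3 < (M' : ℝ) * ν → a ^ M ≤ T ^ M')
    {p q : ℕ} (hpq : (p : ℝ) * Real.log 3 ≤ (q : ℝ) * ν) : a ^ p ≤ T ^ q := by
  set ℓ3 : ℝ := Real.log 3 with hℓ3
  have hℓ3pos : 0 < ℓ3 := Real.log_pos (by norm_num)
  set x : ℝ := Real.log a with hx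
  set y : ℝ := Real.log T with hy
  have hx0 : 0 ≤ x := Real.log_nonneg ha
  have hy0 : 0 ≤ y := Real.log_nonneg hT
  have ha0 : 0 < a := lt_of_lt_of_le zero_lt_one ha
  have hT0 : 0 < T := lt_of_lt_of_le zero_lt_one hT
  have hcore' : ∀ M M' : ℕ, (M : ℝ) * ℓ3 < (M' : ℝ) * ν → (M : ℝ) * x ≤ (M' : ℝ) * y := by
    intro M M' h
    have h1 := Real.log_le_log (pow_pos ha0 M) (hcore M M' h)
    rwa [Real.log_pow, Real.log_pow] at h1
  have hsup : ν / ℓ3 * x ≤ y := by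
    by_contra hlt
    push Not at hlt
    have hxpos : 0 < x := by
      rcases eq_or_lt_of_le hx0 with h | h
      · rw [← h, mul_zero] at hlt
        exact absurd hlt (not_lt.2 hy0)
      · exact h
    have hu : 0 ≤ y / x := by positivity
    have huv : y / x < ν / ℓ3 := by rwa [div_lt_iff₀ hxpos]
    obtain ⟨M, M', hM, hM', hlo, hhi⟩ := exists_nat_div_btwn hu huv
    have hM'pos : (0 : ℝ) < M' := by exact_mod_cast hM'
    have h1 : (M : ℝ) * ℓ3 < (M' : ℝ) * ν := by
      have := (div_lt_div_iff₀ hM'pos hℓ3pos).1 hhi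
      linarith
    have h2 := hcore' M M' h1
    have h3 : y * M' < M * x := (div_lt_div_iff₀ hxpos hM'pos).1 hlo
    nlinarith
  have hlog : (p : ℝ) * x ≤ (q : ℝ) * y := by
    have hq0 : (0 : ℝ) ≤ q := Nat.cast_nonneg q
    have h1 : (p : ℝ) ≤ (q : ℝ) * ν / ℓ3 := by
      rw [le_div_iff₀ hℓ3pos]
      exact hpq
    calc (p : ℝ) * x ≤ ((q : ℝ) * ν / ℓ3) * x := mul_le_mul_of_nonneg_right h1 hx0
      _ = (q : ℝ) * (ν / ℓ3 * x) := by ring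
      _ ≤ (q : ℝ) * y := mul_le_mul_of_nonneg_left hsup hq0
  have e1 : a ^ p = Real.exp ((p : ℝ) * x) := by
    rw [hx, ← Real.log_pow, Real.exp_log (pow_pos ha0 p)]
  have e2 : T ^ q = Real.exp ((q : ℝ) * y) := by
    rw [hy, ← Real.log_pow, Real.exp_log (pow_pos hT0 q)]
  rw [e1, e2]
  exact Real.exp_le_exp.2 hlog

/-- **The real-analysis core of the line.** Germ + layer concentration + entrance ticket give the
sharp finite-`k` transfer `a^p ≤ (t k)^q` whenever `3^p ≤ binom(3k,k)^q`, for every `k`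
(`k = 0`: `p = 0`; `k = 1`: `p ≤ q` and `a ≤ t 1`; `k ≥ 2`: rate chaining + closing). [folklore] -/
theorem transfer_of_germ_of_layerConcentration (ha : 1 ≤ a) (ht : ∀ j, 1 ≤ t j)
    (hG : ∀ p q : ℕ, (3 : ℝ) ^ p < ((27 : ℝ) / 4) ^ q →
      ∃ k₀ : ℕ, ∀ j : ℕ, k₀ ≤ j → a ^ (j * p) ≤ t j ^ q)
    (hLC : ∀ j k p q : ℕ, 1 ≤ j → 2 ≤ k →
      ((27 : ℝ) / 4) ^ (j * p) ≤ ((Nat.choose (3 * k) k : ℕ) : ℝ) ^ q → t j ^ p ≤ t k ^ q)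
    (hE : a ≤ t 1) :
    ∀ k p q : ℕ, 3 ^ p ≤ (Nat.choose (3 * k) k) ^ q → a ^ p ≤ t k ^ q := by
  intro k p q hpq
  rcases Nat.lt_or_ge k 2 with hk | hk
  · interval_cases k
    · -- `k = 0`: `binom(0,0) = 1` forces `p = 0`
      have hp : p = 0 := by
        have h1 : Nat.choose (3 * 0) 0 = 1 := by decide
        rw [h1, one_pow] at hpq
        by_contra h
        have h2 : 1 < 3 ^ p := Nat.one_lt_pow h (by norm_num)
        omega
      subst hp
      rw [pow_zero]
      exact one_le_pow₀ (ht 0)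
    · -- `k = 1`: `binom(3,1) = 3`, so `p ≤ q`
      have h31 : Nat.choose (3 * 1) 1 = 3 := by decide
      rw [h31] at hpq
      have hpq' : p ≤ q := (Nat.pow_le_pow_iff_right (by norm_num)).1 hpq
      calc a ^ p ≤ (t 1) ^ p := pow_le_pow_left₀ (le_trans zero_le_one ha) hE p
        _ ≤ (t 1) ^ q := pow_le_pow_right₀ (ht 1) hpq'
  · have hN2 : 2 ≤ Nat.choose (3 * k) k := by
      have h1 : (k + 1).choose k ≤ (3 * k).choose k := Nat.choose_le_choose k (by omega)
      rw [Nat.choose_succ_self_right] at h1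
      omega
    have hN1 : (1 : ℝ) < ((Nat.choose (3 * k) k : ℕ) : ℝ) := by
      exact_mod_cast (lt_of_lt_of_le one_lt_two hN2)
    have hν : 0 < Real.log ((Nat.choose (3 * k) k : ℕ) : ℝ) := Real.log_pos hN1
    refine pow_le_pow_of_strict_rates ha (ht k) hν
      (fun M M' h => pow_le_pow_of_germ_of_layerConcentration ha ht hG hLC hk h) ?_
    have h' : (3 : ℝ) ^ p ≤ ((Nat.choose (3 * k) k : ℕ) : ℝ) ^ q := by exact_mod_cast hpq
    have h'' := Real.log_le_log (by positivity) h'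
    rwa [Real.log_pow, Real.log_pow] at h''

end Analysis

/-! ## Tensor facts used by the composition (sorry-free) -/

/-- `cw₂ ≠ 0` (entry `1` at `(0,1,1)`). [folklore] -/
theorem cwTensor_two_ne_zero : cwTensor ℂ 2 ≠ 0 := by
  intro h
  have h1 := congrFun (congrFun (congrFun h 0) 1) 1
  have h2 : cwTensor ℂ 2 0 1 1 = 1 := by simp [cwTensor_apply]
  rw [h2] at h1
  simp at h1

/-- `T_k ≠ 0` (entry `1` at any tripartition). [folklore] -/
theorem tripartitionTensor_ne_zero (k : ℕ) : tripartitionTensor ℂ k ≠ 0 := by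
  classical
  have hcard : 0 < Fintype.card (TripartitionIndex k) := by
    rw [TripartitionIndex.card]
    exact Nat.choose_pos (by omega)
  obtain ⟨S⟩ := Fintype.card_pos_iff.1 hcard
  obtain ⟨T, U, hST, hSU, hTU⟩ := S.exists_disjoint_pair
  intro h
  have h1 := congrFun (congrFun (congrFun h S) T) U
  rw [tripartitionTensor_apply_of_disjoint ℂ k hST hSU hTU] at h1
  simp at h1

/-- `1 ≤ [cw₂]` in `T(ℂ)`. [folklore] -/
theorem one_le_mk_cwTensor_two : (1 : TensorClass ℂ) ≤ TensorClass.mk (cwTensor ℂ 2) :=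
  TensorClass.one_le_mk cwTensor_two_ne_zero

/-- `1 ≤ [T_k]` in `T(ℂ)`. [folklore] -/
theorem one_le_mk_tripartitionTensor (k : ℕ) :
    (1 : TensorClass ℂ) ≤ TensorClass.mk (tripartitionTensor ℂ k) :=
  TensorClass.one_le_mk (tripartitionTensor_ne_zero k)

/-! ## The entrance ticket `[cw₂] ≤ [T_1]` (sorry-free)

Over `ℂ` the small Coppersmith–Winograd tensor `cw₂ = Σ_{i=1,2} (e_0 e_i e_i + e_i e_0 e_i + e_i e_i e_0)`
is a restriction of (indeed `GL₃(ℂ)^{×3}`-equivalent to) Pratt's `T_1`, the `S_3` permutation tensor: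
with `w_0 = e_0`, `w_1 = e_1 + i e_2`, `w_2 = e_1 - i e_2` one has `e_1e_1 + e_2e_2 = (w_1w_2 + w_2w_1)/2`,
so `cw₂ = ½ Σ_{σ ∈ S_3} w_{σ0} ⊗ w_{σ1} ⊗ w_{σ2}` (Pratt2024 §1.2: "`T_1` arose in work of Coppersmith and
Winograd"; Kaski–Michałek arXiv:2404.06427 Ex. 11). This is the `≤` half of support item `CwTwoIsTOne`
(stmt-MatrixMultiplication-6573), proved here because `DUp` at `k = 1` needs exactly it. -/

/-- The singleton `{i}` as an index of `T_1`. [folklore] -/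
def sing (i : Fin 3) : TripartitionIndex 1 := ⟨{i}, Finset.card_singleton i⟩

/-- The `S_3` permutation tensor on `Fin 3`: `1` at triples of pairwise distinct indices.
[cite: Pratt2024SCC, Def. 1.4] -/
def permTensorThree : Fin 3 → Fin 3 → Fin 3 → ℂ :=
  fun a b c => if a ≠ b ∧ a ≠ c ∧ b ≠ c then 1 else 0

/-- `T_1` on singletons is the permutation tensor. [folklore] -/
theorem tripartitionTensor_one_sing (a b c : Fin 3) :
    tripartitionTensor ℂ 1 (sing a) (sing b) (sing c) = permTensorThree a b c := by
  simp [tripartitionTensor_apply, sing, permTensorThree]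

/-- `T_1 ≥ perm₃` (relabel along `i ↦ {i}`). [folklore] -/
theorem tripartitionTensor_one_restrictsTo_permTensorThree :
    TensorRestrictsTo (tripartitionTensor ℂ 1) permTensorThree := by
  classical
  have h := tensorRestrictsTo_precomp (tripartitionTensor ℂ 1) sing sing sing
  have e : (fun a b c => tripartitionTensor ℂ 1 (sing a) (sing b) (sing c)) = permTensorThree := by
    funext a b c
    exact tripartitionTensor_one_sing a b c
  rwa [e] at h

/-- Basis-change matrix with columns `w_0 = e_0`, `w_1 = e_1 + i e_2`, `w_2 = e_1 - i e_2`. [folklore] -/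
def cwBasis : Fin 3 → Fin 3 → ℂ :=
  fun x a => ![![(1 : ℂ), 0, 0], ![0, 1, 1], ![0, Complex.I, -Complex.I]] x a

/-- **`perm₃ ≥ cw₂` over `ℂ`**: `cw₂(x,y,z) = Σ_{a,b,c} (½ M_{xa}) M_{yb} M_{zc} perm₃(a,b,c)` with
`M = cwBasis` — the 27 entries checked by `fin_cases`/`simp` (`i·(−i) = 1`). [cite: Pratt2024SCC, §1.2] -/
theorem permTensorThree_restrictsTo_cwTensor_two :
    TensorRestrictsTo permTensorThree (cwTensor ℂ 2) := by
  refine ⟨fun x a => (1 / 2 : ℂ) * cwBasis x a, cwBasis, cwBasis, fun x y z => ?_⟩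
  fin_cases x <;> fin_cases y <;> fin_cases z <;>
    simp [Fin.sum_univ_three, cwTensor_apply, permTensorThree, cwBasis]
  all_goals (try simp only [mul_assoc, Complex.I_mul_I])
  all_goals norm_num

/-- **The entrance ticket `[cw₂] ≤ [T_1]` in `T(ℂ)`** (sorry-free; the `≤` half of item 6573). [folklore] -/
theorem mk_cwTensor_two_le_mk_tripartitionTensor_one :
    TensorClass.mk (cwTensor ℂ 2) ≤ TensorClass.mk (tripartitionTensor ℂ 1) :=
  TensorClass.mk_le_mk_iff.2
    (tripartitionTensor_one_restrictsTo_permTensorThree.trans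
      permTensorThree_restrictsTo_cwTensor_two)

/-! ## The composition: germ + layer concentration (+ the proved entrance ticket) ⟹ `DUp` -/

/-- **Composition with explicit hypotheses** (the BC3 shape `stub₁-sig → stub₂-sig → (entrance) →
crux`, conclusion = the one-step unfolding of `DUp` over `tripartitionTensor ℂ k`, which is the
route's inlined term by `rfl`; the third hypothesis is discharged by the proved
`mk_cwTensor_two_le_mk_tripartitionTensor_one` in `DUp_of`). Strassen's spectral theorem (`asympLe_iff_forall_spectralPoint`,
PROVED in tree) turns every `≲` into inequalities `φ(x) ≤ φ(y)` at each spectral point `φ` of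
`T(ℂ)`; there the three hypotheses become the real hypotheses of
`transfer_of_germ_of_layerConcentration` with `a = φ[cw₂] ≥ 1`, `t j = φ[T_j] ≥ 1`. [folklore] -/
theorem dUp_of_germ_of_layerConcentration
    (hG : ∀ p q : ℕ, (3 : ℝ) ^ p < ((27 : ℝ) / 4) ^ q →
      ∃ k₀ : ℕ, ∀ k : ℕ, k₀ ≤ k →
        AsympLe (fun x y : TensorClass ℂ => x ≤ y)
          ((TensorClass.mk (cwTensor ℂ 2)) ^ (k * p))
          ((TensorClass.mk (tripartitionTensor ℂ k)) ^ q))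
    (hLC : ∀ j k p q : ℕ, 1 ≤ j → 2 ≤ k →
      ((27 : ℝ) / 4) ^ (j * p) ≤ ((Nat.choose (3 * k) k : ℕ) : ℝ) ^ q →
        AsympLe (fun x y : TensorClass ℂ => x ≤ y)
          ((TensorClass.mk (tripartitionTensor ℂ j)) ^ p)
          ((TensorClass.mk (tripartitionTensor ℂ k)) ^ q))
    (hE : TensorClass.mk (cwTensor ℂ 2) ≤ TensorClass.mk (tripartitionTensor ℂ 1)) :
    ∀ k p q : ℕ, 3 ^ p ≤ (Nat.choose (3 * k) k) ^ q →
      AsympLe (fun x y : TensorClass ℂ => x ≤ y)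
        ((TensorClass.mk (cwTensor ℂ 2)) ^ p)
        ((TensorClass.mk (tripartitionTensor ℂ k)) ^ q) := by
  intro k p q hpq
  have hS := TensorClass.isStrassenPreorder ℂ
  refine hS.asympLe_of_forall_spectralPoint _ _ fun φ hφ => ?_
  rw [hφ.map_pow, hφ.map_pow]
  have ha : 1 ≤ φ (TensorClass.mk (cwTensor ℂ 2)) := by
    have h1 := hφ.mono one_le_mk_cwTensor_two
    rwa [hφ.map_one] at h1
  have ht : ∀ j, 1 ≤ φ (TensorClass.mk (tripartitionTensor ℂ j)) := fun j => by
    have h1 := hφ.mono (one_le_mk_tripartitionTensor j)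
    rwa [hφ.map_one] at h1
  have easy : ∀ {x y : TensorClass ℂ},
      AsympLe (fun x y : TensorClass ℂ => x ≤ y) x y → φ x ≤ φ y :=
    fun hxy => (hS.asympLe_iff_forall_spectralPoint).1 hxy φ hφ
  refine transfer_of_germ_of_layerConcentration (a := φ (TensorClass.mk (cwTensor ℂ 2)))
    (t := fun j => φ (TensorClass.mk (tripartitionTensor ℂ j))) ha ht ?_ ?_ ?_ k p q hpq
  · intro p' q' h
    obtain ⟨k₀, hk₀⟩ := hG p' q' h
    refine ⟨k₀, fun j hj => ?_⟩
    have h1 := easy (hk₀ j hj)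
    rwa [hφ.map_pow, hφ.map_pow] at h1
  · intro j k' p' q' hj hk' h
    have h1 := easy (hLC j k' p' q' hj hk' h)
    rwa [hφ.map_pow, hφ.map_pow] at h1
  · exact hφ.mono hE

/-- `DUp` unfolded over `tripartitionTensor ℂ k` (`tripartitionTensor_def` is `rfl`). [folklore] -/
theorem dUp_iff :
    DUp ↔ ∀ k p q : ℕ, 3 ^ p ≤ (Nat.choose (3 * k) k) ^ q →
      AsympLe (fun x y : TensorClass ℂ => x ≤ y)
        ((TensorClass.mk (cwTensor ℂ 2)) ^ p)
        ((TensorClass.mk (tripartitionTensor ℂ k)) ^ q) :=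
  Iff.rfl

/-- **THE SKELETON THEOREM.** The crux
`Summit.MatrixMultiplication.MatrixMultiplication.Theses.TripartitionBridge.DUp`
(stmt-MatrixMultiplication-6568), concluded BY NAME from the two DECLARED stubs `stub_germ`, `stub_layerConcentration` (the only
`sorry`s of the file) and the PROVED entrance ticket `mk_cwTensor_two_le_mk_tripartitionTensor_one`,
through the sorry-free composition `dUp_of_germ_of_layerConcentration`. -/
theorem DUp_of : Summit.MatrixMultiplication.MatrixMultiplication.Theses.TripartitionBridge.DUp :=
  dUp_iff.2 (dUp_of_germ_of_layerConcentration stub_germ stub_layerConcentration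
    mk_cwTensor_two_le_mk_tripartitionTensor_one)

end Summit.MatrixMultiplication.MatrixMultiplication.Cruxes.DUp.Birth

end
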